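import Literature.AnabelianGeometry.SemiGraphs.TemperedCoveringsSubgraphBTemp
import Literature.AnabelianGeometry.SemiGraphs.TemperedChartTransport
import Literature.AnabelianGeometry.SemiGraphs.TemperedMaximalCompact
import Literature.AnabelianGeometry.AbsoluteAnabelian.ProfiniteTerminology
import HarnessLib

/-!
# The decomposition subgroups `Π^tp_ℍ ⊆ Π^tp_𝔾` of a sub-semi-graph in a tempered fundamental group ([IUTchI] §2 p. 44; [SemiAnbd] §3)

Mochizuki, *Inter-universal Teichmüller theory I*, §2 p. 44 l. 39–44: for a (connected) sub-semi-graph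
`ℍ ⊆ 𝔾` "we obtain natural … decomposition groups `Π^tp_ℍ ⊆ Π^tp_𝔾`, `Π̂_ℍ ⊆ Π̂_𝔾` … well-defined up to
conjugation" [cite: Mochizuki2012, IUTchI §2 p.44]; Mochizuki, *Semi-graphs of anabelioids*, Publ. RIMS
**42** (2006), §2 p. 23 (`𝒢_ℍ`), §3 pp. 36–41 (tempered coverings `B^temp(𝒢)`, the tempered fundamental
group `π₁^temp(𝒢)` with `B^temp(π₁^temp(𝒢)) ⥲ B^temp(𝒢)`, Prop. 3.2: continuous homomorphisms are
determined by their pull-back functors up to inner automorphism) [cite: MochizukiSemiAnbd2006, §3 pp.36-41].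

DEFINITIONS file (abc-iut cell, layer L3, row «DECOMP-SUBGRAPH» = GAP row G-w5d028-2 of the L5 cone
§2 block; seat abc-iut-w4-d052 gen 4; vocabulary of abc-iut-L3-t2's `TemperedCoverings.lean` /
`TemperedCoveringsSubgraphBTemp.lean` and abc-iut's `TemperedChartTransport.lean`).  In the tree a
tempered fundamental group is a CHART `c : TemperedPiChart 𝒢` (`c.equiv : B^temp(𝒢) ≌ B^temp(c.G)`), the
verticial subgroups at a vertex `v` are the ranges of the continuous `φ : Π_v → c.G` whose pull-back
`B^temp(φ)` is the restriction `S ↦ S_v` read through the chart (`verticialSubgroups c v`,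
`IsVerticialHom`).  This file does the same for a SUB-SEMI-GRAPH `ℍ`, with the restriction functor
`𝒢.btempRestrict ℍ : B^temp(𝒢) ⥤ B^temp(𝒢_ℍ)` and a chart `c'` of `𝒢_ℍ` in place of `S ↦ S_v`:

* `TemperedPiChart.IsDecompHom c ℍ c' φ` — `φ : c'.G → c.G` (a tempered fundamental group of `𝒢_ℍ` into
  one of `𝒢`) IS A DECOMPOSITION HOMOMORPHISM: `B^temp(φ) ≅ c.equiv⁻¹ ⋙ (restriction to ℍ) ⋙ c'.equiv`;
* `TemperedPiChart.decompSubgroups c ℍ : Set (Subgroup c.G)` — the DECOMPOSITION SUBGROUPS `Π^tp_ℍ`: the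
  ranges of the decomposition homomorphisms (over all charts `c'` of `𝒢_ℍ`);
* laws: `conj_mem_decompSubgroups` (closed under conjugation — the pull-backs of `φ` and `γ_g ∘ φ` are
  isomorphic, `BTemp.resIsoOfConj`), `IsDecompHom.comp_compat` (independence of the chart of `𝒢_ℍ`,
  via `TemperedPiChart.exists_compatIso`), **`exists_conj_of_mem_decompSubgroups`** — the decomposition
  subgroups form ONE `c.G`-conjugacy class ("well-defined up to conjugation", by Prop. 3.2
  `BTemp.exists_conj_of_natTrans` after aligning the charts of `𝒢_ℍ`);
* the printed CLAIM [IUTchI] Prop. 2.2 p. 45 (third inclusion) "`Π^tp_ℍ ⊆ Π^tp_𝔾` is commensurably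
  terminal" as the NAMED TARGET `TemperedPiChart.DecompSubgroupsCommensurablyTerminal c ℍ` (statement
  only — its printed proof is Prop. 2.1 for `ℍ`, i.e. [SemiAnbd] Thm. 3.7-type commensurable terminality
  for the decomposition groups of a sub-semi-graph, which the tree has for single vertices only
  (`verticialCommTerminal`); abc-iut-L5's `TemperedGraphGroupData.prop22_byName` is the chart-free
  interface form it should be compared with).

EXISTENCE of a decomposition homomorphism for given charts is the hypothesis-shaped NAMED TARGET No. 2
`TemperedPiChart.DecompHomExists` (⇒ `decompSubgroups_nonempty_of_exists`), REDUCED here to [SemiAnbd]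
Prop. 3.2 (`TemperoidHomEqRes_holds`): it holds as soon as the restriction functor `btempRestrict ℍ` (read
through the charts) preserves finite limits and countable colimits (`exists_isDecompHom_of_preserves`; for
`ℍ = 𝔾` or a cusp omission the functor is an equivalence, `TemperedCuspOmission*.lean`).  NOT here (honest
scope): that preservation of (co)limits, the single-vertex comparison `decompSubgroups c {v} ↔ verticialSubgroups c v`
(an equivalence `B^temp(𝒢_{{v}}) ≌ B^temp(Π_v)`), and the PROFINITE comparison with the decomposition
groups `range piHToPi` of [SemiAnbd] §2 (`DecompositionGroupRestrict.lean`,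
`Corollary27iHoldsViaDecompositionGroups.lean`: [SemiAnbd] Cor. 2.7 (i) `corollary_2_7_i_holds` BY NAME)
— these are the follow-up rows (P1)/(P3) of G-w5d028-2.  Definitions + definitional laws + the three
structural theorems; no instance, no notation, no axiom; nothing here takes a side on [IUTchIII] Cor. 3.12.
-/

namespace Literature.AnabelianGeometry.SemiGraphs

namespace ProfiniteSemiGraph

open CategoryTheory
open scoped Pointwise
open Literature.AnabelianGeometry.AbsoluteAnabelian (IsCommensurablyTerminal)

universe u

variable {𝒢 : ProfiniteSemiGraph.{u}}

namespace TemperedPiChart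

/-! ### Decomposition homomorphisms and decomposition subgroups -/

/-- `φ : π₁^temp(𝒢_ℍ) → π₁^temp(𝒢)` (charts `c'` of `𝒢_ℍ`, `c` of `𝒢`) *is a decomposition homomorphism
of the sub-semi-graph `ℍ`*: its pull-back functor `B^temp(φ) : B^temp(c.G) ⥤ B^temp(c'.G)` is
isomorphic to the restriction `B^temp(𝒢) → B^temp(𝒢_ℍ)`, `S ↦ S|_ℍ`, read through the two charts —
the sub-semi-graph analogue of `IsVerticialHom` ([SemiAnbd] Thm. 3.7 (i): "the natural continuous …
outer homomorphism"). [cite: Mochizuki2012, IUTchI §2 p.44] -/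
def IsDecompHom (c : TemperedPiChart 𝒢) (H : 𝒢.graph.Subgraph) (c' : TemperedPiChart (𝒢.restrict H))
    (φ : c'.G →ₜ* c.G) : Prop :=
  Nonempty (c.equiv.inverse ⋙ 𝒢.btempRestrict H ⋙ c'.equiv.functor ≅ BTemp.res φ)

/-- **The decomposition subgroups `Π^tp_ℍ ⊆ Π^tp_𝔾 = c.G` of the sub-semi-graph `ℍ`** ([IUTchI] §2
p. 44: "natural … decomposition groups `Π^tp_ℍ ⊆ Π^tp_𝔾` … well-defined up to conjugation"): the
ranges of the decomposition homomorphisms `π₁^temp(𝒢_ℍ) → c.G`, over all charts of `𝒢_ℍ` — the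
sub-semi-graph analogue of `verticialSubgroups c v`.  (Intended for CONNECTED `ℍ`; for an `ℍ` without
tempered fundamental group the set is empty.) [cite: Mochizuki2012, IUTchI §2 p.44] -/
def decompSubgroups (c : TemperedPiChart 𝒢) (H : 𝒢.graph.Subgraph) : Set (Subgroup c.G) :=
  {D | ∃ (c' : TemperedPiChart (𝒢.restrict H)) (φ : c'.G →ₜ* c.G),
    c.IsDecompHom H c' φ ∧ D = φ.toMonoidHom.range}

variable {c : TemperedPiChart 𝒢} {H : 𝒢.graph.Subgraph}

/-- Membership in `decompSubgroups` (definitional). [cite: Mochizuki2012, IUTchI §2 p.44] -/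
theorem mem_decompSubgroups_iff {D : Subgroup c.G} :
    D ∈ c.decompSubgroups H ↔ ∃ (c' : TemperedPiChart (𝒢.restrict H)) (φ : c'.G →ₜ* c.G),
      c.IsDecompHom H c' φ ∧ D = φ.toMonoidHom.range := Iff.rfl

/-- The range of a decomposition homomorphism is a decomposition subgroup.
[cite: Mochizuki2012, IUTchI §2 p.44] -/
theorem IsDecompHom.range_mem {c' : TemperedPiChart (𝒢.restrict H)} {φ : c'.G →ₜ* c.G}
    (h : c.IsDecompHom H c' φ) : φ.toMonoidHom.range ∈ c.decompSubgroups H :=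
  ⟨c', φ, h, rfl⟩

/-! ### Conjugation invariance -/

/-- `γ_g ∘ φ` is a decomposition homomorphism if `φ` is (the pull-back functors are isomorphic,
`BTemp.resIsoOfConj`). [cite: MochizukiSemiAnbd2006, Prop 3.2 p.35] -/
theorem IsDecompHom.conj {c' : TemperedPiChart (𝒢.restrict H)} {φ : c'.G →ₜ* c.G}
    (h : c.IsDecompHom H c' φ) (g : c.G) (ψ : c'.G →ₜ* c.G) (hg : ∀ a, g * φ a * g⁻¹ = ψ a) :
    c.IsDecompHom H c' ψ := by
  obtain ⟨e⟩ := h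
  exact ⟨e ≪≫ BTemp.resIsoOfConj φ ψ g hg⟩

/-- **Decomposition subgroups are closed under conjugation.** [cite: Mochizuki2012, IUTchI §2 p.44] -/
theorem conj_mem_decompSubgroups {D : Subgroup c.G} (hD : D ∈ c.decompSubgroups H) (g : c.G) :
    D.map (MulAut.conj g).toMonoidHom ∈ c.decompSubgroups H := by
  obtain ⟨c', φ, hφ, rfl⟩ := hD
  haveI := c.isTopologicalGroup
  -- `γ_g ∘ φ` as a continuous homomorphism
  let ψ : c'.G →ₜ* c.G :=
    { toMonoidHom := (MulAut.conj g).toMonoidHom.comp φ.toMonoidHom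
      continuous_toFun := by
        exact ((continuous_const.mul continuous_id).mul continuous_const).comp φ.continuous }
  have hg : ∀ a, g * φ a * g⁻¹ = ψ a := fun a => rfl
  exact ⟨c', ψ, hφ.conj g ψ hg, (range_eq_map_conj_of_conj_eq c φ ψ g hg).symm⟩

/-! ### Independence of the chart of `𝒢_ℍ` -/

/-- **Change of chart of `𝒢_ℍ`.**  If `φ : c'.G → c.G` is a decomposition homomorphism and
`χ : c''.G → c'.G` is compatible with the charts `c'`, `c''` of `𝒢_ℍ` (`B^temp(χ) ≅ c'.equiv⁻¹ ⋙
c''.equiv`, as supplied by `TemperedPiChart.exists_compatIso c'' c'`), then `φ ∘ χ : c''.G → c.G` is a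
decomposition homomorphism. [cite: MochizukiSemiAnbd2006, Prop 3.6(ii) p.38] -/
theorem IsDecompHom.comp_compat {c' c'' : TemperedPiChart (𝒢.restrict H)} {φ : c'.G →ₜ* c.G}
    (h : c.IsDecompHom H c' φ) (χ : c''.G →ₜ* c'.G)
    (hχ : Nonempty (c'.equiv.inverse ⋙ c''.equiv.functor ≅ BTemp.res χ)) :
    c.IsDecompHom H c'' (φ.comp χ) := by
  obtain ⟨e⟩ := h
  obtain ⟨k⟩ := hχ
  refine ⟨?_⟩
  -- insert `c'.equiv.functor ⋙ c'.equiv.inverse ≅ 𝟭` after the restriction, then whisker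
  exact (Functor.isoWhiskerLeft (c.equiv.inverse ⋙ 𝒢.btempRestrict H)
      ((c''.equiv.functor.leftUnitor.symm ≪≫
        Functor.isoWhiskerRight c'.equiv.unitIso c''.equiv.functor) :
        c''.equiv.functor ≅ (c'.equiv.functor ⋙ c'.equiv.inverse) ⋙ c''.equiv.functor) :
      c.equiv.inverse ⋙ 𝒢.btempRestrict H ⋙ c''.equiv.functor ≅
        (c.equiv.inverse ⋙ 𝒢.btempRestrict H ⋙ c'.equiv.functor) ⋙
          (c'.equiv.inverse ⋙ c''.equiv.functor)) ≪≫
    Functor.isoWhiskerRight e (c'.equiv.inverse ⋙ c''.equiv.functor) ≪≫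
    Functor.isoWhiskerLeft (BTemp.res φ) k ≪≫
    (Iso.refl _ : BTemp.res φ ⋙ BTemp.res χ ≅ BTemp.res (φ.comp χ))

/-! ### One conjugacy class -/

/-- **The decomposition subgroups of `ℍ` form ONE conjugacy class in `π₁^temp(𝒢)`** ("well-defined up
to conjugation", [IUTchI] p. 44): after aligning the two charts of `𝒢_ℍ` (`exists_compatIso`), two
decomposition homomorphisms out of the same chart have isomorphic pull-back functors, hence differ by
an inner automorphism ([SemiAnbd] Prop. 3.2, `BTemp.exists_conj_of_natTrans`).
[cite: Mochizuki2012, IUTchI §2 p.44] -/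
theorem exists_conj_of_mem_decompSubgroups {D D' : Subgroup c.G} (hD : D ∈ c.decompSubgroups H)
    (hD' : D' ∈ c.decompSubgroups H) : ∃ g : c.G, D' = D.map (MulAut.conj g).toMonoidHom := by
  obtain ⟨c', φ, ⟨e⟩, rfl⟩ := hD
  obtain ⟨c'', φ', ⟨e'⟩, rfl⟩ := hD'
  -- align the charts of `𝒢_ℍ`: `χ : c''.G ≅ c'.G` compatible with the chart equivalences
  obtain ⟨χ, ω, hωχ, hχω, hχ, -⟩ := TemperedPiChart.exists_compatIso c'' c'
  -- `φ ∘ χ` is a decomposition homomorphism out of `c''` with the same range as `φ`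
  obtain ⟨e₁⟩ := (IsDecompHom.comp_compat (c := c) ⟨e⟩ χ hχ)
  have hsurj : Function.Surjective χ := fun y => ⟨ω y, hχω y⟩
  have hrange : (φ.comp χ).toMonoidHom.range = φ.toMonoidHom.range := by
    change (φ.toMonoidHom.comp χ.toMonoidHom).range = _
    rw [MonoidHom.range_comp, MonoidHom.range_eq_top.mpr hsurj, ← MonoidHom.range_eq_map]
  -- two decomposition homomorphisms out of the same chart differ by an inner automorphism
  obtain ⟨g, hg, -⟩ := BTemp.exists_conj_of_natTrans c.isTempered (φ.comp χ) φ' (e₁.symm ≪≫ e').hom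
  exact ⟨g, by rw [← hrange]; exact range_eq_map_conj_of_conj_eq c (φ.comp χ) φ' g hg⟩

/-! ### Existence of decomposition homomorphisms: reduction to [SemiAnbd] Prop. 3.2 -/

/-- **NAMED TARGET No. 2 — existence of the natural homomorphism `π₁^temp(𝒢_ℍ) → π₁^temp(𝒢)`**
([IUTchI] §2 p. 44 "natural … decomposition groups"; [SemiAnbd] §3 p. 38): for every chart `c'` of
`𝒢_ℍ` there is a decomposition homomorphism `c'.G → c.G`.  Hypothesis-shaped (statement only): it is
[SemiAnbd] Prop. 3.2 (surjectivity, the tree's `TemperoidHomEqRes_holds`) applied to the restriction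
functor, which requires `B^temp(𝒢) → B^temp(𝒢_ℍ)` to be a MORPHISM OF TEMPEROIDS (finite limits and
countable colimits preserved) — see `decompHomExists_of_preserves`.  Nothing is asserted.
[cite: MochizukiSemiAnbd2006, Prop 3.2 p.35] -/
def DecompHomExists (c : TemperedPiChart 𝒢) (H : 𝒢.graph.Subgraph) : Prop :=
  ∀ c' : TemperedPiChart (𝒢.restrict H), ∃ φ : c'.G →ₜ* c.G, c.IsDecompHom H c' φ

/-- Under the existence target every chart of `𝒢_ℍ` yields a decomposition subgroup: the consumer's
`Nonempty (decompSubgroups c ℍ)`. [cite: Mochizuki2012, IUTchI §2 p.44] -/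
theorem decompSubgroups_nonempty_of_exists (h : c.DecompHomExists H)
    (c' : TemperedPiChart (𝒢.restrict H)) : (c.decompSubgroups H).Nonempty := by
  obtain ⟨φ, hφ⟩ := h c'
  exact ⟨_, hφ.range_mem⟩

/-- **Reduction of the existence target to [SemiAnbd] Prop. 3.2.**  If the restriction functor read
through the charts, `c.equiv⁻¹ ⋙ (B^temp(𝒢) → B^temp(𝒢_ℍ)) ⋙ c'.equiv : B^temp(c.G) ⥤ B^temp(c'.G)`,
preserves finite limits and countable colimits (i.e. is the pull-back of a morphism of temperoids,
[SemiAnbd] Def. 3.1 (iii)), then a decomposition homomorphism `c'.G → c.G` EXISTS — by the tree's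
Prop. 3.2 `TemperoidHomEqRes_holds`. [cite: MochizukiSemiAnbd2006, Prop 3.2 p.35] -/
theorem exists_isDecompHom_of_preserves (c' : TemperedPiChart (𝒢.restrict H))
    (hlim : Limits.PreservesFiniteLimits (c.equiv.inverse ⋙ 𝒢.btempRestrict H ⋙ c'.equiv.functor))
    (hcolim : ∀ (J : Type) [SmallCategory J] [CountableCategory J],
      Limits.PreservesColimitsOfShape J (c.equiv.inverse ⋙ 𝒢.btempRestrict H ⋙ c'.equiv.functor)) :
    ∃ φ : c'.G →ₜ* c.G, c.IsDecompHom H c' φ := by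
  haveI := c.secondCountableTopology
  haveI := c'.secondCountableTopology
  let Φ : TemperoidHom (BTemp c'.G) (BTemp c.G) :=
    ⟨c.equiv.inverse ⋙ 𝒢.btempRestrict H ⋙ c'.equiv.functor, hlim, fun J _ _ => hcolim J⟩
  obtain ⟨φ, hφ⟩ := TemperoidHomEqRes_holds c'.G c.G c'.isTempered c.isTempered Φ
  exact ⟨φ, hφ⟩

/-! ### [IUTchI] Prop. 2.2 (third inclusion) as a named target -/

/-- **NAMED TARGET — [IUTchI] Prop. 2.2** (p. 45), third inclusion "`Π^tp_ℍ ⊆ Π^tp_𝔾`" of the list of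
COMMENSURABLY TERMINAL inclusions ("`Π^tp_ℍ ⊆ Π^tp_𝔾`, … are commensurably terminal"): every
decomposition subgroup `D ∈ decompSubgroups c ℍ` is commensurably terminal in `c.G = π₁^temp(𝒢)`
(the tree's `IsCommensurablyTerminal`, [AbsAnab] Def. 0.1 (iii): `C_{c.G}(D) = D`).  Statement only
(typed target over the new vocabulary; its printed proof is Prop. 2.1 applied to `ℍ`, i.e. [SemiAnbd]
Thm. 3.7-type commensurable terminality for sub-semi-graph decomposition groups, available in the tree
for single vertices; abc-iut-L5's `TemperedGraphGroupData.prop22_byName` is the chart-free interface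
form).  Tagged `[claim: Mochizuki2012, status: disputed]` as every [IUTchI] item; nothing is asserted.
[cite: Mochizuki2012, IUTchI Prop 2.2 p.45] -/
def DecompSubgroupsCommensurablyTerminal (c : TemperedPiChart 𝒢) (H : 𝒢.graph.Subgraph) : Prop :=
  ∀ D ∈ c.decompSubgroups H, IsCommensurablyTerminal D

-- adapted from abc-iut-L5-t6's `commensurator_smul_eq_smul` (`ProSigmaFreeFactorDisjoint.lean`)
/-- Commensurable terminality passes to conjugates: `C(g D g⁻¹) = g C(D) g⁻¹ = g D g⁻¹`. [folklore] -/
private theorem isCommensurablyTerminal_map_conj {D : Subgroup c.G} (hD : IsCommensurablyTerminal D)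
    (g : c.G) : IsCommensurablyTerminal (D.map (MulAut.conj g).toMonoidHom) := by
  change IsCommensurablyTerminal (ConjAct.toConjAct g • D)
  refine ⟨?_⟩
  ext x
  rw [Subgroup.Commensurable.commensurator_mem_iff, Subgroup.mem_pointwise_smul_iff_inv_smul_mem,
    ← mul_smul, Subgroup.Commensurable.commensurable_conj (ConjAct.toConjAct g)⁻¹, ← mul_smul, ← mul_smul,
    inv_mul_cancel, one_smul]
  have hx : (ConjAct.toConjAct g)⁻¹ * (ConjAct.toConjAct x * ConjAct.toConjAct g) =
      ConjAct.toConjAct ((ConjAct.toConjAct g)⁻¹ • x) := by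
    simp [ConjAct.smul_def, mul_assoc]
  rw [hx, ← Subgroup.Commensurable.commensurator_mem_iff, hD.commensurator_eq]

/-- The target reduces to ONE decomposition subgroup: all others are its conjugates
(`exists_conj_of_mem_decompSubgroups`) and commensurable terminality passes to conjugates.
[cite: Mochizuki2012, IUTchI Prop 2.2 p.45] -/
theorem decompSubgroupsCommensurablyTerminal_of_one {D₀ : Subgroup c.G}
    (h₀ : D₀ ∈ c.decompSubgroups H) (hct : IsCommensurablyTerminal D₀) :
    c.DecompSubgroupsCommensurablyTerminal H := by
  intro D hD
  obtain ⟨g, rfl⟩ := exists_conj_of_mem_decompSubgroups h₀ hD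
  exact isCommensurablyTerminal_map_conj hct g

end TemperedPiChart

end ProfiniteSemiGraph

end Literature.AnabelianGeometry.SemiGraphs
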